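import Mathlib
/-!
# (Cap) OF RULE E — the arithmetic of the five-point case (night-3 g10)
NIGHT3-G10-CAPE-PROOF.md §4.1–4.2, as one inequality between naturals. With `R` the rank, `ℓ = |cl T₀|`,
`f = |F₀|`, `q = ρ(F₀)`, `N = |G_{T₀}|` and `k` the number of paying outer pairs, the load of a five-point set with
a collinear triple is at most
`Φ + 3·I + k/(6(R−3))`, `Φ = [4 ≤ p₀]·C(p₀,2)/(6·C(f,2))`, `I = (C(p,2) − N)⁺/(6(ℓ−2)N)`,
`p₀ = min(R, q + min(ℓ−3, 2))`, `p = min(R, q + min(ℓ−2, 2))`, under the constraints `R ≥ 5`, `ℓ ≥ 3`,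
`R − 2 ≤ q ≤ min(f, R)`, `C(R−2,2) + (f−R+2)(R−3) ≤ N ≤ C(f,2)`, `k ≤ 6`, `k = 0` when
`C(min(R,f+1),2) ≤ C(R−2,2) + (ℓ+f−R)(R−3)`, and `k ≤ 3` when `f = 4` and `N = 5`.
`capE_triple_arith` proves it `≤ 1`: the tails `R ≥ 8`, `f ≥ R + 2`, `ℓ ≥ 6` symbolically (the load decreases in
`ℓ`, vanishes in `f`, is crude for `R ≥ 8`), the rest by `decide` on the cleared-denominator form
(`tripleNum ≤ tripleDen`; 3 × 3 × 4 ranges of `R, ℓ, f`, `q`, `N ≤ 28`, `k ≤ 6`).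
-/
namespace PercRepro
namespace CapEArith

/-- `p₀`: the largest possible corank of the triple. -/
def pZero (R ℓ q : ℕ) : ℕ := min R (q + min (ℓ - 3) 2)

/-- `p`: the largest possible corank of an inner pair. -/
def pIn (R ℓ q : ℕ) : ℕ := min R (q + min (ℓ - 2) 2)

/-- The cleared-denominator numerator of the load bound. -/
def tripleNum (R ℓ f q N k : ℕ) : ℕ :=
  (if 4 ≤ pZero R ℓ q then Nat.choose (pZero R ℓ q) 2 else 0) * ((ℓ - 2) * N * (R - 3)) +
    3 * (Nat.choose (pIn R ℓ q) 2 - N) * (Nat.choose f 2 * (R - 3)) +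
    k * (Nat.choose f 2 * ((ℓ - 2) * N))

/-- The common denominator `6·C(f,2)·(ℓ−2)·N·(R−3)`. -/
def tripleDen (R ℓ f N : ℕ) : ℕ := 6 * (Nat.choose f 2 * ((ℓ - 2) * N * (R - 3)))

/-- The constraints of the five-point case. -/
def Constr (R ℓ f q N k : ℕ) : Prop :=
  5 ≤ R ∧ 3 ≤ ℓ ∧ R - 2 ≤ q ∧ q ≤ f ∧ q ≤ R ∧
    Nat.choose (R - 2) 2 + (f - (R - 2)) * (R - 3) ≤ N ∧ N ≤ Nat.choose f 2 ∧ k ≤ 6 ∧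
    (Nat.choose (min R (f + 1)) 2 ≤ Nat.choose (R - 2) 2 + (ℓ + f - 2 - (R - 2)) * (R - 3) → k = 0) ∧
    (f = 4 → N = 5 → k ≤ 3)

/-- The constraints are decidable. -/
instance (R ℓ f q N k : ℕ) : Decidable (Constr R ℓ f q N k) := by unfold Constr; infer_instance

/-- The finite part in offset form: `R = a + 5`, `ℓ = b + 3`, `f = R − 2 + φ`, `q = R − 2 + c`,
`N = C(R−2,2) + φ(R−3) + d`. -/
def FiniteClaim (a b φ c d k : ℕ) : Prop :=
  Constr (a + 5) (b + 3) (a + 3 + φ) (a + 3 + c) (Nat.choose (a + 3) 2 + φ * (a + 2) + d) k →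
    tripleNum (a + 5) (b + 3) (a + 3 + φ) (a + 3 + c) (Nat.choose (a + 3) 2 + φ * (a + 2) + d) k ≤
      tripleDen (a + 5) (b + 3) (a + 3 + φ) (Nat.choose (a + 3) 2 + φ * (a + 2) + d)

/-- The finite claim is decidable. -/
instance (a b φ c d k : ℕ) : Decidable (FiniteClaim a b φ c d k) := by unfold FiniteClaim; infer_instance

set_option synthInstance.maxSize 2000 in
/-- **The finite part**: `R ∈ [5,7]`, `ℓ ∈ [3,5]`, `f ∈ [R−2, R+1]`, `q ∈ [R−2, R]`, `N ∈ [N_min, N_min + 28]`,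
`k ≤ 6`, checked by `decide` (3 · 3 · 4 · 3 · 29 · 7 = 21,924 cases). -/
theorem finite_part : ∀ a, a < 3 → ∀ b, b < 3 → ∀ φ, φ < 4 → ∀ c, c < 3 → ∀ d, d < 29 → ∀ k, k < 7 →
    FiniteClaim a b φ c d k := by
  decide

/-- The load bound of a five-point set with a collinear triple, as a rational: the fat share, three inner shares,
`k` outer shares. -/
noncomputable def loadBound (R ℓ f q N k : ℕ) : ℚ :=
  (if 4 ≤ pZero R ℓ q then ((Nat.choose (pZero R ℓ q) 2 : ℕ) : ℚ) / (6 * ((Nat.choose f 2 : ℕ) : ℚ)) else 0) +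
    3 * (((Nat.choose (pIn R ℓ q) 2 - N : ℕ) : ℚ) / (6 * ((ℓ - 2 : ℕ) : ℚ) * (N : ℚ))) +
    (k : ℚ) / (6 * ((R - 3 : ℕ) : ℚ))

/-- `loadBound = tripleNum / tripleDen`. -/
theorem loadBound_eq (R ℓ f q N k : ℕ) (hf : 2 ≤ f) (hℓ : 3 ≤ ℓ) (hN : 1 ≤ N) (hR : 4 ≤ R) :
    loadBound R ℓ f q N k = (tripleNum R ℓ f q N k : ℚ) / (tripleDen R ℓ f N : ℚ) := by
  have hCf : (0 : ℚ) < ((Nat.choose f 2 : ℕ) : ℚ) := by exact_mod_cast Nat.choose_pos hf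
  have hA : (0 : ℚ) < ((ℓ - 2 : ℕ) : ℚ) := by exact_mod_cast (show 0 < ℓ - 2 by omega)
  have hB : (0 : ℚ) < ((R - 3 : ℕ) : ℚ) := by exact_mod_cast (show 0 < R - 3 by omega)
  have hNq : (0 : ℚ) < (N : ℚ) := by exact_mod_cast hN
  unfold loadBound tripleNum tripleDen
  by_cases h4 : 4 ≤ pZero R ℓ q
  · simp only [if_pos h4]
    push_cast
    field_simp
  · simp only [if_neg h4]
    push_cast
    field_simp
    ring

/-- **The finite part, bridged**: `R ≤ 7`, `ℓ ≤ 5`, `f ≤ R + 1` give `loadBound ≤ 1`. -/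
theorem loadBound_le_one_of_small {R ℓ f q N k : ℕ} (h : Constr R ℓ f q N k) (hR7 : R ≤ 7) (hℓ5 : ℓ ≤ 5)
    (hfR : f ≤ R + 1) : loadBound R ℓ f q N k ≤ 1 := by
  obtain ⟨h5, hℓ, hq1, hq2, hq3, hN1, hN2, hk, hk0, hk3⟩ := h
  have hNmin : Nat.choose (R - 2) 2 ≤ N := le_trans (Nat.le_add_right _ _) hN1
  have hN1' : 1 ≤ N := le_trans (Nat.choose_pos (by omega)) hNmin
  have hf2 : 2 ≤ f := by omega
  rw [loadBound_eq R ℓ f q N k hf2 hℓ hN1' (by omega), div_le_one (by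
    have h1 : 0 < Nat.choose f 2 := Nat.choose_pos hf2
    have : 0 < tripleDen R ℓ f N := by
      unfold tripleDen
      have h2 : 0 < ℓ - 2 := by omega
      have h3 : 0 < R - 3 := by omega
      positivity
    exact_mod_cast this)]
  -- offsets
  have hN28 : N ≤ 28 := by
    have : Nat.choose f 2 ≤ Nat.choose 8 2 := Nat.choose_le_choose 2 (by omega)
    have h8 : Nat.choose 8 2 = 28 := by decide
    omega
  obtain ⟨a, rfl⟩ : ∃ a, R = a + 5 := ⟨R - 5, by omega⟩
  obtain ⟨b, rfl⟩ : ∃ b, ℓ = b + 3 := ⟨ℓ - 3, by omega⟩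
  obtain ⟨φ, hφ⟩ : ∃ φ, f = a + 3 + φ := ⟨f - (a + 3), by omega⟩
  obtain ⟨c, hc⟩ : ∃ c, q = a + 3 + c := ⟨q - (a + 3), by omega⟩
  have hNmin' : Nat.choose (a + 3) 2 + φ * (a + 2) ≤ N := by
    have : a + 5 - 2 = a + 3 := by omega
    have h' : a + 5 - 3 = a + 2 := by omega
    rw [this, h'] at hN1
    rw [hφ] at hN1
    have : a + 3 + φ - (a + 3) = φ := by omega
    rw [this] at hN1
    exact hN1
  obtain ⟨d, hd⟩ : ∃ d, N = Nat.choose (a + 3) 2 + φ * (a + 2) + d := ⟨N - (Nat.choose (a + 3) 2 + φ * (a + 2)), by omega⟩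
  have hclaim := finite_part a (by omega) b (by omega) φ (by omega) c (by omega) d (by
    have h3 : 3 ≤ Nat.choose (a + 3) 2 := by
      have := Nat.choose_le_choose 2 (show 3 ≤ a + 3 by omega)
      have h33 : Nat.choose 3 2 = 3 := by decide
      omega
    omega) k (by omega)
  unfold FiniteClaim at hclaim
  rw [← hφ, ← hc, ← hd] at hclaim
  exact_mod_cast hclaim ⟨h5, hℓ, hq1, hq2, hq3, hN1, hN2, hk, hk0, hk3⟩

/-- `pZero` and `pIn` do not depend on `ℓ` once `ℓ ≥ 5`. -/
theorem pZero_eq_of_five_le {R ℓ q : ℕ} (h : 5 ≤ ℓ) : pZero R ℓ q = pZero R 5 q := by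
  unfold pZero
  have : min (ℓ - 3) 2 = 2 := by omega
  rw [this]
  norm_num

/-- `pIn` does not depend on `ℓ` once `ℓ ≥ 4`. -/
theorem pIn_eq_of_four_le {R ℓ q : ℕ} (h : 4 ≤ ℓ) : pIn R ℓ q = pIn R 5 q := by
  unfold pIn
  have : min (ℓ - 2) 2 = 2 := by omega
  rw [this]
  norm_num

/-- **The load decreases in `ℓ` beyond `5`.** -/
theorem loadBound_le_of_five_le {R ℓ f q N k : ℕ} (h : 5 ≤ ℓ) (hN : 1 ≤ N) :
    loadBound R ℓ f q N k ≤ loadBound R 5 f q N k := by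
  unfold loadBound
  rw [pZero_eq_of_five_le h, pIn_eq_of_four_le (by omega)]
  have hNq : (0 : ℚ) < (N : ℚ) := by exact_mod_cast hN
  have hA : (3 : ℚ) ≤ ((ℓ - 2 : ℕ) : ℚ) := by exact_mod_cast (show 3 ≤ ℓ - 2 by omega)
  have h3 : ((5 - 2 : ℕ) : ℚ) = 3 := by norm_num
  rw [h3]
  have hD : (0 : ℚ) ≤ ((Nat.choose (pIn R 5 q) 2 - N : ℕ) : ℚ) := by positivity
  have : ((Nat.choose (pIn R 5 q) 2 - N : ℕ) : ℚ) / (6 * ((ℓ - 2 : ℕ) : ℚ) * (N : ℚ)) ≤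
      ((Nat.choose (pIn R 5 q) 2 - N : ℕ) : ℚ) / (6 * 3 * (N : ℚ)) := by
    apply div_le_div_of_nonneg_left hD (by positivity)
    nlinarith
  linarith

/-- The constraints transfer from `ℓ ≥ 5` to `ℓ = 5`. -/
theorem constr_five {R ℓ f q N k : ℕ} (h : Constr R ℓ f q N k) (hℓ : 5 ≤ ℓ) : Constr R 5 f q N k := by
  obtain ⟨h5, _, hq1, hq2, hq3, hN1, hN2, hk, hk0, hk3⟩ := h
  refine ⟨h5, by norm_num, hq1, hq2, hq3, hN1, hN2, hk, ?_, hk3⟩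
  intro hc
  apply hk0
  refine hc.trans ?_
  apply Nat.add_le_add_left
  apply Nat.mul_le_mul_right
  omega

/-- `C(m+2, 2) = C(m, 2) + 2m + 1`. -/
theorem choose_two_add_two (m : ℕ) : Nat.choose (m + 2) 2 = Nat.choose m 2 + 2 * m + 1 := by
  have h1 : Nat.choose (m + 2) 2 = Nat.choose (m + 1) 1 + Nat.choose (m + 1) 2 := Nat.choose_succ_succ (m + 1) 1
  have h2 : Nat.choose (m + 1) 2 = Nat.choose m 1 + Nat.choose m 2 := Nat.choose_succ_succ m 1
  rw [h1, h2, Nat.choose_one_right, Nat.choose_one_right]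
  omega

/-- `C(R, 2) = C(R−2, 2) + (2R − 3)` for `R ≥ 2`. -/
theorem choose_two_eq_sub_two {R : ℕ} (hR : 2 ≤ R) : Nat.choose R 2 = Nat.choose (R - 2) 2 + (2 * R - 3) := by
  have hR' : R = (R - 2) + 2 := by omega
  conv_lhs => rw [hR']
  rw [choose_two_add_two]
  omega

/-- **The tail `f ≥ R + 2`**: no inner share, no outer share, fat share `≤ 1/6`. -/
theorem loadBound_le_one_of_big_f {R ℓ f q N k : ℕ} (h : Constr R ℓ f q N k) (hf : R + 2 ≤ f) :
    loadBound R ℓ f q N k ≤ 1 := by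
  obtain ⟨h5, hℓ, hq1, hq2, hq3, hN1, hN2, hk, hk0, hk3⟩ := h
  -- `k = 0`
  have hk0' : k = 0 := by
    apply hk0
    have h1 : Nat.choose (min R (f + 1)) 2 ≤ Nat.choose R 2 := Nat.choose_le_choose 2 (min_le_left _ _)
    have h2 : Nat.choose R 2 = Nat.choose (R - 2) 2 + (2 * R - 3) := choose_two_eq_sub_two (by omega)
    have h3 : 2 * R - 3 ≤ (ℓ + f - 2 - (R - 2)) * (R - 3) := by
      have : 5 ≤ ℓ + f - 2 - (R - 2) := by omega
      have : 5 * (R - 3) ≤ (ℓ + f - 2 - (R - 2)) * (R - 3) := Nat.mul_le_mul_right _ this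
      omega
    omega
  -- no inner share
  have hinner : Nat.choose (pIn R ℓ q) 2 - N = 0 := by
    have h1 : Nat.choose (pIn R ℓ q) 2 ≤ Nat.choose R 2 := Nat.choose_le_choose 2 (min_le_left _ _)
    have h2 : Nat.choose R 2 = Nat.choose (R - 2) 2 + (2 * R - 3) := choose_two_eq_sub_two (by omega)
    have h3 : 2 * R - 3 ≤ (f - (R - 2)) * (R - 3) := by
      have : 4 ≤ f - (R - 2) := by omega
      have : 4 * (R - 3) ≤ (f - (R - 2)) * (R - 3) := Nat.mul_le_mul_right _ this
      omega
    omega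
  -- fat share `≤ 1/6`
  have hfat : (if 4 ≤ pZero R ℓ q then ((Nat.choose (pZero R ℓ q) 2 : ℕ) : ℚ) / (6 * ((Nat.choose f 2 : ℕ) : ℚ))
      else 0) ≤ 1 / 6 := by
    split_ifs
    · have h1 : Nat.choose (pZero R ℓ q) 2 ≤ Nat.choose f 2 :=
        Nat.choose_le_choose 2 ((min_le_left _ _).trans (by omega))
      have hCf : (0 : ℚ) < ((Nat.choose f 2 : ℕ) : ℚ) := by exact_mod_cast Nat.choose_pos (by omega)
      rw [div_le_iff₀ (by positivity)]
      have : ((Nat.choose (pZero R ℓ q) 2 : ℕ) : ℚ) ≤ ((Nat.choose f 2 : ℕ) : ℚ) := by exact_mod_cast h1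
      linarith
    · norm_num
  unfold loadBound
  rw [hinner, hk0']
  simp only [Nat.cast_zero, zero_div, mul_zero, add_zero]
  linarith

set_option maxHeartbeats 400000 in
/-- **The tail `R ≥ 8`**: the crude bounds `Φ ≤ C(R,2)/(6C(R−2,2))`, `3I ≤ 3(C(R,2) − C(R−2,2))/(6C(R−2,2))`,
`k/(6(R−3)) ≤ 1/(R−3)` sum to at most `1`. -/
theorem loadBound_le_one_of_big_R {R ℓ f q N k : ℕ} (h : Constr R ℓ f q N k) (hR : 8 ≤ R) :
    loadBound R ℓ f q N k ≤ 1 := by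
  obtain ⟨h5, hℓ, hq1, hq2, hq3, hN1, hN2, hk, hk0, hk3⟩ := h
  have hNmin : Nat.choose (R - 2) 2 ≤ N := le_trans (Nat.le_add_right _ _) hN1
  have hCR : Nat.choose R 2 = Nat.choose (R - 2) 2 + (2 * R - 3) := choose_two_eq_sub_two (by omega)
  have hCm : ((Nat.choose (R - 2) 2 : ℕ) : ℚ) = ((R : ℚ) - 2) * ((R : ℚ) - 3) / 2 := by
    rw [Nat.cast_choose_two, Nat.cast_sub (by omega)]; push_cast; ring
  have hRq : (8 : ℚ) ≤ R := by exact_mod_cast hR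
  have hNq : ((R : ℚ) - 2) * ((R : ℚ) - 3) / 2 ≤ N := by rw [← hCm]; exact_mod_cast hNmin
  have hNpos : (0 : ℚ) < N := by nlinarith
  have hA : (1 : ℚ) ≤ ((ℓ - 2 : ℕ) : ℚ) := by exact_mod_cast (show 1 ≤ ℓ - 2 by omega)
  have hB : ((R - 3 : ℕ) : ℚ) = (R : ℚ) - 3 := by rw [Nat.cast_sub (by omega)]; push_cast; ring
  -- the three pieces
  have hfat : (if 4 ≤ pZero R ℓ q then ((Nat.choose (pZero R ℓ q) 2 : ℕ) : ℚ) / (6 * ((Nat.choose f 2 : ℕ) : ℚ))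
      else 0) ≤ ((R : ℚ) * ((R : ℚ) - 1) / 2) / (6 * (((R : ℚ) - 2) * ((R : ℚ) - 3) / 2)) := by
    split_ifs
    · have h1 : Nat.choose (pZero R ℓ q) 2 ≤ Nat.choose R 2 := Nat.choose_le_choose 2 (min_le_left _ _)
      have h2 : Nat.choose (R - 2) 2 ≤ Nat.choose f 2 := Nat.choose_le_choose 2 (by omega)
      have h1q : ((Nat.choose (pZero R ℓ q) 2 : ℕ) : ℚ) ≤ (R : ℚ) * ((R : ℚ) - 1) / 2 := by
        rw [← Nat.cast_choose_two]; exact_mod_cast h1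
      have h2q : ((R : ℚ) - 2) * ((R : ℚ) - 3) / 2 ≤ ((Nat.choose f 2 : ℕ) : ℚ) := by
        rw [← hCm]; exact_mod_cast h2
      have hpos : (0 : ℚ) < ((R : ℚ) - 2) * ((R : ℚ) - 3) / 2 := by nlinarith
      calc ((Nat.choose (pZero R ℓ q) 2 : ℕ) : ℚ) / (6 * ((Nat.choose f 2 : ℕ) : ℚ))
          ≤ ((R : ℚ) * ((R : ℚ) - 1) / 2) / (6 * ((Nat.choose f 2 : ℕ) : ℚ)) :=
            div_le_div_of_nonneg_right h1q (by positivity)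
        _ ≤ ((R : ℚ) * ((R : ℚ) - 1) / 2) / (6 * (((R : ℚ) - 2) * ((R : ℚ) - 3) / 2)) := by
            apply div_le_div_of_nonneg_left (by nlinarith) (mul_pos (by norm_num) hpos)
            linarith
    · apply div_nonneg <;> nlinarith
  have hinner : 3 * (((Nat.choose (pIn R ℓ q) 2 - N : ℕ) : ℚ) / (6 * ((ℓ - 2 : ℕ) : ℚ) * (N : ℚ))) ≤
      3 * ((2 * (R : ℚ) - 3) / (6 * (((R : ℚ) - 2) * ((R : ℚ) - 3) / 2))) := by
    have h1 : Nat.choose (pIn R ℓ q) 2 - N ≤ 2 * R - 3 := by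
      have := Nat.choose_le_choose 2 (min_le_left R (q + min (ℓ - 2) 2))
      unfold pIn
      omega
    have h1q : ((Nat.choose (pIn R ℓ q) 2 - N : ℕ) : ℚ) ≤ 2 * (R : ℚ) - 3 := by
      have : ((2 * R - 3 : ℕ) : ℚ) = 2 * (R : ℚ) - 3 := by rw [Nat.cast_sub (by omega)]; push_cast; ring
      rw [← this]; exact_mod_cast h1
    have hpos : (0 : ℚ) < ((R : ℚ) - 2) * ((R : ℚ) - 3) / 2 := by nlinarith
    apply mul_le_mul_of_nonneg_left _ (by norm_num)
    calc ((Nat.choose (pIn R ℓ q) 2 - N : ℕ) : ℚ) / (6 * ((ℓ - 2 : ℕ) : ℚ) * (N : ℚ))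
        ≤ (2 * (R : ℚ) - 3) / (6 * ((ℓ - 2 : ℕ) : ℚ) * (N : ℚ)) := div_le_div_of_nonneg_right h1q (by positivity)
      _ ≤ (2 * (R : ℚ) - 3) / (6 * (((R : ℚ) - 2) * ((R : ℚ) - 3) / 2)) := by
          apply div_le_div_of_nonneg_left (by linarith) (mul_pos (by norm_num) hpos)
          nlinarith
  have houter : (k : ℚ) / (6 * ((R - 3 : ℕ) : ℚ)) ≤ 1 / ((R : ℚ) - 3) := by
    rw [hB]
    have hkq : (k : ℚ) ≤ 6 := by exact_mod_cast hk
    rw [div_le_div_iff₀ (by linarith) (by linarith)]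
    nlinarith
  unfold loadBound
  have hpos : (0 : ℚ) < ((R : ℚ) - 2) * ((R : ℚ) - 3) / 2 := by nlinarith
  have hsum : ((R : ℚ) * ((R : ℚ) - 1) / 2) / (6 * (((R : ℚ) - 2) * ((R : ℚ) - 3) / 2)) +
      3 * ((2 * (R : ℚ) - 3) / (6 * (((R : ℚ) - 2) * ((R : ℚ) - 3) / 2))) + 1 / ((R : ℚ) - 3) ≤ 1 := by
    have hR3 : (0 : ℚ) < (R : ℚ) - 3 := by linarith
    have hR2 : (0 : ℚ) < (R : ℚ) - 2 := by linarith
    have heq : ((R : ℚ) * ((R : ℚ) - 1) / 2) / (6 * (((R : ℚ) - 2) * ((R : ℚ) - 3) / 2)) +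
        3 * ((2 * (R : ℚ) - 3) / (6 * (((R : ℚ) - 2) * ((R : ℚ) - 3) / 2))) + 1 / ((R : ℚ) - 3) =
        ((R : ℚ) * ((R : ℚ) - 1) + 6 * (2 * (R : ℚ) - 3) + 6 * ((R : ℚ) - 2)) / (6 * ((R : ℚ) - 2) * ((R : ℚ) - 3)) := by
      field_simp
      ring
    rw [heq, div_le_one (by positivity)]
    nlinarith
  linarith

/-- **THE ARITHMETIC LEMMA**: under the constraints, the load bound is at most `1`. -/
theorem loadBound_le_one {R ℓ f q N k : ℕ} (h : Constr R ℓ f q N k) : loadBound R ℓ f q N k ≤ 1 := by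
  have hN1 : 1 ≤ N := by
    obtain ⟨h5, _, _, _, _, hN1, _⟩ := h
    have := Nat.choose_pos (show 2 ≤ R - 2 by omega)
    omega
  rcases Nat.lt_or_ge R 8 with hR | hR
  · rcases Nat.lt_or_ge f (R + 2) with hf | hf
    · rcases Nat.lt_or_ge ℓ 6 with hℓ | hℓ
      · exact loadBound_le_one_of_small h (by omega) (by omega) (by omega)
      · exact (loadBound_le_of_five_le (by omega) hN1).trans
          (loadBound_le_one_of_small (constr_five h (by omega)) (by omega) (by norm_num) (by omega))
    · exact loadBound_le_one_of_big_f h hf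
  · exact loadBound_le_one_of_big_R h hR

end CapEArith
end PercRepro
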